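import Mathlib
import Summits.Ventures.PercRepro2.RowC1Decomp
import Summits.Ventures.PercRepro2.RowC1DetH

/-!
# Row 2′C1 ⟸ its L-part (blind cell PercRepro2, p2 g31; proofs/P2-G31-DETH.md §3)

With the exact decomposition `slack = det_H + det_L + T2 + T3` (`RowC1Decomp.lean`) and the theorem
`det_H ≥ 0` (`RowC1DetH.lean`), row 2′C1 follows from the nonnegativity of its **L-part**

  `m_HN·m_NL ≤ m_HL·m_NN + P(Q, b ∈ C₂, o ∈ U)·P(Q, b ∈ C₁) + P(Q, b ∈ C₁, o ∈ U)·P(Q, b ∉ C₂)`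

(`LPartNonneg`, a CONJECTURE of the cell: 0 exact violations in 80 ratio-maximising descents,
tight; not two-copy typed-positive — the seed's `−1` of RowC1Triple.lean lives in it — but
three-copy typed-positive in every test).  `c1_of_lpart`: `LPartNonneg ⟹ row 2′C1`.  Std axioms.
-/

namespace Summit.Ventures.PercRepro2

namespace RowC1

section LPart

open Classical

variable {V : Type*} {E : Type*} [Fintype E] [DecidableEq E] [Fintype V] [DecidableEq V]
  {R : Type*} [CommRing R] [LinearOrder R] [IsStrictOrderedRing R]

/-- **The L-part of row 2′C1** (a Prop):
`m_HN·m_NL ≤ m_HL·m_NN + P(Q, b ∈ C₂, o ∈ U)·P(Q, b ∈ C₁) + P(Q, b ∈ C₁, o ∈ U)·P(Q, b ∉ C₂)`. -/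
def LPartNonneg (p : E → R) (ends : E → Sym2 V) (a₁ a₂ o b : V) : Prop :=
  prob p (connEvent ends a₂ b ∩ (connEvent ends a₁ o ∪ connEvent ends a₂ o)ᶜ ∩
        (connEvent ends a₁ a₂)ᶜ) *
      prob p ((connEvent ends a₁ b ∪ connEvent ends a₂ b)ᶜ ∩ connEvent ends a₁ o ∩
        (connEvent ends a₁ a₂)ᶜ) ≤
    prob p (connEvent ends a₂ b ∩ connEvent ends a₁ o ∩ (connEvent ends a₁ a₂)ᶜ) *
        prob p ((connEvent ends a₁ b ∪ connEvent ends a₂ b)ᶜ ∩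
          (connEvent ends a₁ o ∪ connEvent ends a₂ o)ᶜ ∩ (connEvent ends a₁ a₂)ᶜ) +
      prob p (connEvent ends a₂ b ∩ (connEvent ends a₁ o ∪ connEvent ends a₂ o) ∩
          (connEvent ends a₁ a₂)ᶜ) *
        prob p (connEvent ends a₁ b ∩ (connEvent ends a₁ a₂)ᶜ) +
      prob p (connEvent ends a₁ b ∩ (connEvent ends a₁ o ∪ connEvent ends a₂ o) ∩
          (connEvent ends a₁ a₂)ᶜ) *
        prob p ((connEvent ends a₂ b)ᶜ ∩ (connEvent ends a₁ a₂)ᶜ)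

/-- **Row 2′C1 from the L-part**: with `det_H ≥ 0` (`detH_nonneg`), the nonnegativity of the
L-part gives `P(Q, b ∈ C₂)·P(Q, o ∈ U) ≤ P(Q)·P(Q, o ∈ U, b ∈ U)`. -/
theorem c1_of_lpart (p : E → R) (hp : IsProbVec p) (ends : E → Sym2 V) (a₁ a₂ o b : V)
    (hL : LPartNonneg p ends a₁ a₂ o b) :
    prob p (connEvent ends a₂ b ∩ (connEvent ends a₁ a₂)ᶜ) *
      prob p ((connEvent ends a₁ o ∪ connEvent ends a₂ o) ∩ (connEvent ends a₁ a₂)ᶜ) ≤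
    prob p (connEvent ends a₁ a₂)ᶜ *
      prob p ((connEvent ends a₁ o ∪ connEvent ends a₂ o) ∩
        (connEvent ends a₁ b ∪ connEvent ends a₂ b) ∩ (connEvent ends a₁ a₂)ᶜ) := by
  unfold LPartNonneg at hL
  have h := slack_eq_detH_add_lpart p ends a₁ a₂ o b
  have hdet := detH_nonneg p hp ends a₁ a₂ o b
  linarith [h, hdet, hL]

end LPart

end RowC1

end Summit.Ventures.PercRepro2
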